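import Literature.AlgebraicGeometry.AbelianSchemes.ModuleSliceOfBaseChange
import Literature.AlgebraicGeometry.AbelianSchemes.AbelianSchemeDualTransport
import Literature.AlgebraicGeometry.AbelianSchemes.PoincareUniversalLocality
import Mathlib.AlgebraicGeometry.Sites.Fpqc
import HarnessLib

/-!
# Uniqueness of the classifying map for a descended Poincaré sheaf, from the stabiliser of the cover family

Layer `Literature/AlgebraicGeometry/AbelianSchemes`, namespace `Literature.AlgebraicGeometry.AbelianSchemes.AbelianSchemeOver`.
THEOREMS ONLY; no definition, no named fact, no instance, no notation, no `sorry`.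

Setting ([MumfordAV1970] §15 Thm. 1 «the dual of `A/C` is `Â/C^⊥`», the UNIQUENESS half of the universal property of the
descended Poincaré sheaf; [MilneAV2008] I §8–§9): abelian schemes `A`, `B′`, `B` over `S` (think `A = A′/K`, `B′ = Â′`,
`B = Â′/K′`), an `S`-morphism `q : B′ → B` which is an fpqc COVER (surjective, flat, quasi-compact — e.g. the free finite
quotient `ψ̂ : Â′ → Â′/K′`), a module `N` on `A ×_S B′` (the family `𝒩₁ = (π × 1)^*𝒫`) and a module `P` on `A ×_S B` with
`(1_A × q)^* P ≅ N` (the descended Poincaré sheaf, rigidified or not).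

* **`eq_of_pullback_baseChangeToProd_iso_of_stabilizer`** — if the SCHEME-THEORETIC STABILISER of `N` is the kernel pair of
  `q` — hypothesis (K): for all `f : T → S` and `a a′ : T → B′` over `f`, `(1_A × a)^* N ≅ (1_A × a′)^* N` implies
  `a ≫ q = a′ ≫ q` — then two `S`-morphisms `g₁ g₂ : T → B` with `(1_A × g₁)^* P ≅ (1_A × g₂)^* P` are EQUAL, for EVERY test
  scheme `T` (no reducedness).  Proof: on the fpqc cover `T₁ := (T ×_{B} B′) ×_T (T ×_{B} B′) → T` both `gᵢ` lift to
  `aᵢ : T₁ → B′`; there `(1 × (c ≫ gᵢ))^* P ≅ (1 × aᵢ)^* (1 × q)^* P ≅ (1 × aᵢ)^* N` (★ `prodMap_comp_baseChangeToProd`, ★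
  `baseChangeToProd_comp`, ★ `baseChangeToProd_eq_whiskerLeft_left`), so (K) gives `c ≫ g₁ = c ≫ g₂`, and `c` is an
  epimorphism of schemes (Mathlib: surjective + flat + quasi-compact ⇒ `EffectiveEpi`, fpqc descent of morphisms,
  [GortzWedhorn2020] Thm. 14.72);
* `existsUnique_of_exists_of_stabilizer` — hence the `∃!` of ★ `DualPair.universal` for `(B, P)` follows from its `∃` half and (K).

(K) is where «`K′ = K^⊥`» lives (the `e_n`-pairing content of [MumfordAV1970] §15): it says that every `T`-valued point of `B′`
stabilising `N` lies in the kernel pair of `q`, i.e. that the stabiliser subgroup scheme of `N` is the (constant) group by which `q`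
divides.  It is a SEPARATE input (cell `hodgecm-mathlib`, HECKE-LINK H2 (ii) D6, brick (u4)); this file is the reduction (u3) of
uniqueness over ALL `T` to (K).  HC_CM is proved only modulo the 7 printed citations until rung 0 closes; nothing here is about HC.

## References
* [MumfordAV1970] D. Mumford, *Abelian Varieties* (1970), §15 Thm. 1 (p. 143), §13 (p. 125).
* [MilneAV2008] J. S. Milne, *Abelian Varieties* (2008), I §8 (pp. 36–37), I §9 Thm. 9.1 (p. 42).
* [GortzWedhorn2020] U. Görtz, T. Wedhorn, *Algebraic Geometry I*, 2nd ed. (2020), Thm. 14.72 (fpqc descent of morphisms).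
-/

noncomputable section

-- `(A.X ⊗ B.X).left = A.prodLeft B` and `(A.baseChange f).X.left = pullback A.X.hom f` hold by `rfl` only.
set_option backward.isDefEq.respectTransparency false

universe u

open CategoryTheory CategoryTheory.Limits AlgebraicGeometry MonoidalCategory CartesianMonoidalCategory

namespace Literature.AlgebraicGeometry.AbelianSchemes

namespace AbelianSchemeOver

open Literature.AlgebraicGeometry.Motives

variable {S : Scheme.{u}} (A B' B : AbelianSchemeOver S) (q : B'.X ⟶ B.X)
  (N : (A.prodLeft B').Modules) (P : (A.prodLeft B).Modules)

/-- `(1_A × a)^* (1_A × q)^* P ≅ (1_A × (a ≫ q))^* P` for an `S`-morphism `q : B′ → B` and `a : T → B′` over `f`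
(★ `baseChangeToProd_comp` + ★ `baseChangeToProd_eq_whiskerLeft_left`). [cite: MilneAV2008, I §8 (pp. 36–37)] -/
theorem nonempty_pullback_baseChangeToProd_pullback_whiskerLeft_iso {T : Scheme.{u}} (f : T ⟶ S) (a : T ⟶ B'.X.left)
    (ha : a ≫ B'.X.hom = f) :
    Nonempty ((Scheme.Modules.pullback (A.baseChangeToProd B' f a ha)).obj
        ((Scheme.Modules.pullback (A.X ◁ q).left).obj P) ≅
      (Scheme.Modules.pullback (A.baseChangeToProd B f (a ≫ q.left)
        (by rw [Category.assoc, Over.w q, ha]))).obj P) := by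
  refine ⟨(Scheme.Modules.pullbackComp _ _).app P ≪≫ (Scheme.Modules.pullbackCongr ?_).app P⟩
  rw [← A.baseChangeToProd_eq_whiskerLeft_left B q]
  exact (DualPair.baseChangeToProd_comp (A := A) (B := B) (B' := B') f a q.left ha (Over.w q)).symm

/-- `(1_A × w)^* (1_A × g)^* P ≅ (1_A × (w ≫ g))^* P` (★ `prodMap_comp_baseChangeToProd`). [cite: MilneAV2008, I §8 (pp. 36–37)] -/
theorem nonempty_pullback_prodMap_pullback_baseChangeToProd_iso {T₁ T : Scheme.{u}} (f₁ : T₁ ⟶ S) (f : T ⟶ S) (w : T₁ ⟶ T)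
    (hw : w ≫ f = f₁) (g : T ⟶ B.X.left) (hg : g ≫ B.X.hom = f) :
    Nonempty ((Scheme.Modules.pullback (A.prodMap f₁ f w hw)).obj
        ((Scheme.Modules.pullback (A.baseChangeToProd B f g hg)).obj P) ≅
      (Scheme.Modules.pullback (A.baseChangeToProd B f₁ (w ≫ g) (by rw [Category.assoc, hg, hw]))).obj P) :=
  ⟨(Scheme.Modules.pullbackComp _ _).app P ≪≫
    (Scheme.Modules.pullbackCongr (A.prodMap_comp_baseChangeToProd B f₁ f w hw g hg)).app P⟩

/-- **Uniqueness of the classifying map from the stabiliser hypothesis (K), over EVERY test scheme.**  Let `q : B′ → B` be an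
fpqc cover over `S`, `(1_A × q)^* P ≅ N`, and assume (K): `T`-valued points `a, a′` of `B′` with `(1_A × a)^* N ≅ (1_A × a′)^* N`
have `a ≫ q = a′ ≫ q`.  Then `S`-morphisms `g₁ g₂ : T → B` with `(1_A × g₁)^* P ≅ (1_A × g₂)^* P` are equal: both lift to `B′`
on the fpqc cover `T₁ = (T ×_B B′) ×_T (T ×_B B′)`, where (K) applies, and `T₁ → T` is an epimorphism of schemes (fpqc descent
of morphisms). [cite: MumfordAV1970, §15 Thm. 1 (p. 143)] [cite: GortzWedhorn2020, Thm. 14.72] -/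
theorem eq_of_pullback_baseChangeToProd_iso_of_stabilizer [Surjective q.left] [Flat q.left] [QuasiCompact q.left]
    (eP : Nonempty ((Scheme.Modules.pullback (A.X ◁ q).left).obj P ≅ N))
    (hK : ∀ {T : Scheme.{u}} (f : T ⟶ S) (a a' : T ⟶ B'.X.left) (ha : a ≫ B'.X.hom = f) (ha' : a' ≫ B'.X.hom = f),
      Nonempty ((Scheme.Modules.pullback (A.baseChangeToProd B' f a ha)).obj N ≅
        (Scheme.Modules.pullback (A.baseChangeToProd B' f a' ha')).obj N) → a ≫ q.left = a' ≫ q.left)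
    {T : Scheme.{u}} (f : T ⟶ S) (g₁ g₂ : T ⟶ B.X.left) (hg₁ : g₁ ≫ B.X.hom = f) (hg₂ : g₂ ≫ B.X.hom = f)
    (h : Nonempty ((Scheme.Modules.pullback (A.baseChangeToProd B f g₁ hg₁)).obj P ≅
      (Scheme.Modules.pullback (A.baseChangeToProd B f g₂ hg₂)).obj P)) :
    g₁ = g₂ := by
  obtain ⟨e⟩ := h
  obtain ⟨eP⟩ := eP
  -- the fpqc cover `T₁ → T` on which both `gᵢ` lift to `B′`
  let c : pullback (pullback.fst g₁ q.left) (pullback.fst g₂ q.left) ⟶ T :=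
    pullback.fst (pullback.fst g₁ q.left) (pullback.fst g₂ q.left) ≫ pullback.fst g₁ q.left
  let a₁ : pullback (pullback.fst g₁ q.left) (pullback.fst g₂ q.left) ⟶ B'.X.left :=
    pullback.fst (pullback.fst g₁ q.left) (pullback.fst g₂ q.left) ≫ pullback.snd g₁ q.left
  let a₂ : pullback (pullback.fst g₁ q.left) (pullback.fst g₂ q.left) ⟶ B'.X.left :=
    pullback.snd (pullback.fst g₁ q.left) (pullback.fst g₂ q.left) ≫ pullback.snd g₂ q.left
  have hc₁ : c ≫ g₁ = a₁ ≫ q.left := by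
    simp only [c, a₁, Category.assoc]
    rw [pullback.condition (f := g₁) (g := q.left)]
  have hc₂ : c ≫ g₂ = a₂ ≫ q.left := by
    have hc : c = pullback.snd (pullback.fst g₁ q.left) (pullback.fst g₂ q.left) ≫ pullback.fst g₂ q.left :=
      pullback.condition
    rw [hc, Category.assoc, pullback.condition (f := g₂) (g := q.left)]
    simp only [a₂, Category.assoc]
  have ha₁ : a₁ ≫ B'.X.hom = c ≫ f := by rw [← Over.w q, ← Category.assoc, ← hc₁, Category.assoc, hg₁]
  have ha₂ : a₂ ≫ B'.X.hom = c ≫ f := by rw [← Over.w q, ← Category.assoc, ← hc₂, Category.assoc, hg₂]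
  -- `(1 × (c ≫ gᵢ))^* P ≅ (1 × aᵢ)^* N`
  have iso : ∀ (a : _ ⟶ B'.X.left) (g : T ⟶ B.X.left) (hg : g ≫ B.X.hom = f) (ha : a ≫ B'.X.hom = c ≫ f)
      (hcg : c ≫ g = a ≫ q.left),
      Nonempty ((Scheme.Modules.pullback (A.prodMap (c ≫ f) f c rfl)).obj
          ((Scheme.Modules.pullback (A.baseChangeToProd B f g hg)).obj P) ≅
        (Scheme.Modules.pullback (A.baseChangeToProd B' (c ≫ f) a ha)).obj N) := by
    intro a g hg ha hcg
    obtain ⟨i₁⟩ := A.nonempty_pullback_prodMap_pullback_baseChangeToProd_iso B P (c ≫ f) f c rfl g hg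
    obtain ⟨i₂⟩ := A.nonempty_pullback_baseChangeToProd_pullback_whiskerLeft_iso B' B q P (c ≫ f) a ha
    refine ⟨i₁ ≪≫ (Scheme.Modules.pullbackCongr (A.baseChangeToProd_congr B (c ≫ f) hcg _ _)).app P ≪≫ i₂.symm ≪≫
      (Scheme.Modules.pullback _).mapIso eP⟩
  obtain ⟨j₁⟩ := iso a₁ g₁ hg₁ ha₁ hc₁
  obtain ⟨j₂⟩ := iso a₂ g₂ hg₂ ha₂ hc₂
  have key : a₁ ≫ q.left = a₂ ≫ q.left :=
    hK (c ≫ f) a₁ a₂ ha₁ ha₂ ⟨j₁.symm ≪≫ (Scheme.Modules.pullback _).mapIso e ≪≫ j₂⟩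
  -- `c` is an fpqc cover, hence an epimorphism
  haveI : Surjective c := inferInstance
  haveI : Flat c := inferInstance
  haveI : QuasiCompact c := inferInstance
  haveI : Epi c := inferInstance
  rw [← cancel_epi c, hc₁, hc₂, key]

/-- **Hence `∃!`**: under (K), the existence half of the universal property of `(B, P)` upgrades to the `∃!` of ★
`DualPair.universal`. [cite: MumfordAV1970, §15 Thm. 1 (p. 143)] [cite: MilneAV2008, I §9 Thm. 9.1 (p. 42)] -/
theorem existsUnique_of_exists_of_stabilizer [Surjective q.left] [Flat q.left] [QuasiCompact q.left]
    (eP : Nonempty ((Scheme.Modules.pullback (A.X ◁ q).left).obj P ≅ N))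
    (hK : ∀ {T : Scheme.{u}} (f : T ⟶ S) (a a' : T ⟶ B'.X.left) (ha : a ≫ B'.X.hom = f) (ha' : a' ≫ B'.X.hom = f),
      Nonempty ((Scheme.Modules.pullback (A.baseChangeToProd B' f a ha)).obj N ≅
        (Scheme.Modules.pullback (A.baseChangeToProd B' f a' ha')).obj N) → a ≫ q.left = a' ≫ q.left)
    {T : Scheme.{u}} (f : T ⟶ S) (L : (A.baseChange f).X.left.Modules)
    (hex : ∃ g : {g : T ⟶ B.X.left // g ≫ B.X.hom = f},
      Nonempty ((Scheme.Modules.pullback (A.baseChangeToProd B f g.1 g.2)).obj P ≅ L)) :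
    ∃! g : {g : T ⟶ B.X.left // g ≫ B.X.hom = f},
      Nonempty ((Scheme.Modules.pullback (A.baseChangeToProd B f g.1 g.2)).obj P ≅ L) := by
  obtain ⟨g, ⟨eg⟩⟩ := hex
  refine ⟨g, ⟨eg⟩, fun g' ⟨eg'⟩ => Subtype.ext ?_⟩
  exact A.eq_of_pullback_baseChangeToProd_iso_of_stabilizer B' B q N P eP hK f g'.1 g.1 g'.2 g.2 ⟨eg' ≪≫ eg.symm⟩

end AbelianSchemeOver

end Literature.AlgebraicGeometry.AbelianSchemes

end
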